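import Literature.AlgebraicGeometry.Frobenioids.BiratUnitsPerfectSections
import HarnessLib

/-!
# [FrdI] §0: functoriality of `M ↦ M^pf` and extension to the perfection ACROSS UNIVERSES
# (universe-polymorphic twins of `Perfection.map`, `Perfection.extend`, `gpPerfSection`)

Mochizuki, *The geometry of Frobenioids I: the general theory*, Kyushu J. Math. **62** (2008) 293–400, §0
"Monoids", kurims text p. 11 ("`M^pf := lim_→ M`"; "`M` is perfect if … `M → M^pf` is an isomorphism")
[cite: MochizukiFrdI2008, §0 p.11].

abc-iut cell, layer L1, row M13-c3 «FILE B-arch» / (S)-assembly (HOME/staging/L1/L1-t6/g3/M13-c3-DESIGN.md;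
seat abc-iut-L1-t6).  The tree's `Perfection.map` (`MonoidFunctors.lean`), `Perfection.extend`
(`RealifiedDivisorMonoidsOfRlfQ.lean`) and abc-iut-w5-d194's `gpPerfSection` (`BiratUnitsPerfectSections.lean`)
pin SOURCE AND TARGET TO ONE UNIVERSE, whereas the radial section of the archimedean perfection,
`Φ(d) = ℝ_{≥0} → O^×(X^birat)`, goes from universe `0` into `Type (max u v)` (the universe of the base
`π : D → D₀`).  This file supplies the universe-polymorphic versions, with the same API:
`Perfection.mapU`, `Perfection.extendU` (+ `extendU_of`, `extendU_comp_of`), `gpPerfSectionU`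
(+ `gpPerfSectionU_of`, `_of_of`, `_of_mk_pow`, `comp_gpPerfSectionU_eq_id`, `apply_gpPerfSectionU`).
Classical monoid algebra; no `def … : Prop`; nothing here bears on [IUTchIII] Cor. 3.12.
-/

noncomputable section

namespace Literature.AlgebraicGeometry.Frobenioids

open Function Literature.AnabelianGeometry.EtaleTheta

namespace Perfection

universe u v

variable {M : Type u} [CommMonoid M] {N : Type v} [CommMonoid N]

/-- `M^pf → N^pf`, `a^{1/n} ↦ f(a)^{1/n}`, for `M`, `N` in ARBITRARY universes (twin of `Perfection.map`).
[cite: MochizukiFrdI2008, §0 p.11] -/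
def mapU (f : M →* N) : Perfection M →* Perfection N where
  toFun := Quotient.map (fun x => (f x.1, x.2)) fun x y ⟨K, h⟩ => ⟨K, by
    show f x.1 ^ ((K : ℕ) * (y.2 : ℕ)) = f y.1 ^ ((K : ℕ) * (x.2 : ℕ))
    rw [← map_pow, ← map_pow, h]⟩
  map_one' := by
    show mk (f 1) 1 = mk 1 1
    rw [map_one]
  map_mul' x y := by
    obtain ⟨⟨a, n⟩, rfl⟩ := mk_surjective x
    obtain ⟨⟨b, m⟩, rfl⟩ := mk_surjective y
    show mk (f (a ^ (m : ℕ) * b ^ (n : ℕ))) (n * m) = mk (f a ^ (m : ℕ) * f b ^ (n : ℕ)) (n * m)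
    rw [map_mul, map_pow, map_pow]

/-- `mapU f` on classes. [cite: MochizukiFrdI2008, §0 p.11] -/
@[simp] theorem mapU_mk (f : M →* N) (a : M) (n : ℕ+) : mapU f (mk a n) = mk (f a) n := rfl

/-- Naturality of `M → M^pf` for `mapU`. [cite: MochizukiFrdI2008, §0 p.11] -/
theorem mapU_comp_of (f : M →* N) : (mapU f).comp (of M) = (of N).comp f := rfl

/-- **Extension to the perfection, across universes**: `f : M → Q` into a PERFECT `Q` extends to
`M^pf → Q` as `M^pf → Q^pf ≅ Q`. [cite: MochizukiFrdI2008, §0 p.11] -/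
def extendU {Q : Type v} [CommMonoid Q] (hQ : IsPerfect Q) (f : M →* Q) : Perfection M →* Q :=
  (MulEquiv.ofBijective (Perfection.of Q) (isPerfect_iff_bijective_of.mp hQ)).symm.toMonoidHom.comp (mapU f)

/-- The extension restricts to `f` on `M`. [cite: MochizukiFrdI2008, §0 p.11] -/
@[simp] theorem extendU_of {Q : Type v} [CommMonoid Q] (hQ : IsPerfect Q) (f : M →* Q) (a : M) :
    extendU hQ f (Perfection.of M a) = f a := by
  change (MulEquiv.ofBijective (Perfection.of Q) (isPerfect_iff_bijective_of.mp hQ)).symm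
      (mapU f (Perfection.of M a)) = f a
  rw [MulEquiv.symm_apply_eq]
  rfl

/-- As a composite: `extendU ∘ of = f`. [cite: MochizukiFrdI2008, §0 p.11] -/
theorem extendU_comp_of {Q : Type v} [CommMonoid Q] (hQ : IsPerfect Q) (f : M →* Q) :
    (extendU hQ f).comp (Perfection.of M) = f :=
  MonoidHom.ext (extendU_of hQ f)

/-- The value on a class `[a^{1/n}]` is THE `n`-th root of `f a`: `(extendU hQ f [a^{1/n}])ⁿ = f a`.
[cite: MochizukiFrdI2008, §0 p.11] -/
theorem extendU_mk_pow {Q : Type v} [CommMonoid Q] (hQ : IsPerfect Q) (f : M →* Q) (a : M) (n : ℕ+) :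
    extendU hQ f (mk a n) ^ (n : ℕ) = f a := by
  rw [← map_pow, mk_pow_self, extendU_of]

end Perfection

/-! ### Sections `(M^pf)^gp → B` from monoid-level sections, across universes -/

section Sections

universe u v

variable {M : Type u} [CommMonoid M] {B : Type v} [CommGroup B]

/-- For PERFECT `B` (any universe): the extension `(M^pf)^gp → B` of `σ₀ : M → B`
(`GrothendieckGroup.lift ∘ Perfection.extendU`; twin of abc-iut-w5-d194's `gpPerfSection`).
[cite: MochizukiFrdI2008, §0 p.11] -/
def gpPerfSectionU (hB : IsPerfect B) (σ₀ : M →* B) : Algebra.GrothendieckGroup (Perfection M) →* B :=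
  Algebra.GrothendieckGroup.lift (Perfection.extendU hB σ₀)

/-- `gpPerfSectionU` on `M^pf ⊆ (M^pf)^gp` is `Perfection.extendU hB σ₀`. [cite: MochizukiFrdI2008, §0 p.11] -/
@[simp] theorem gpPerfSectionU_of (hB : IsPerfect B) (σ₀ : M →* B) (p : Perfection M) :
    gpPerfSectionU hB σ₀ (Algebra.GrothendieckGroup.of p) = Perfection.extendU hB σ₀ p :=
  gp_lift_of _ p

/-- `gpPerfSectionU` restricts to `σ₀` on `M`. [cite: MochizukiFrdI2008, §0 p.11] -/
@[simp] theorem gpPerfSectionU_of_of (hB : IsPerfect B) (σ₀ : M →* B) (a : M) :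
    gpPerfSectionU hB σ₀ (Algebra.GrothendieckGroup.of (Perfection.of M a)) = σ₀ a := by
  rw [gpPerfSectionU_of, Perfection.extendU_of]

/-- `(gpPerfSectionU hB σ₀ [a^{1/n}])ⁿ = σ₀ a`. [cite: MochizukiFrdI2008, §0 p.11] -/
theorem gpPerfSectionU_of_mk_pow (hB : IsPerfect B) (σ₀ : M →* B) (a : M) (n : ℕ+) :
    gpPerfSectionU hB σ₀ (Algebra.GrothendieckGroup.of (Perfection.mk a n)) ^ (n : ℕ) = σ₀ a := by
  rw [gpPerfSectionU_of, Perfection.extendU_mk_pow]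

/-- **A monoid-level section of `δ : B → (M^pf)^gp` extends to a section on `(M^pf)^gp`** (perfect `B`, any
universe): `δ (σ₀ a) = [a]` for all `a ∈ M` ⇒ `δ ∘ gpPerfSectionU hB σ₀ = id`. [cite: MochizukiFrdI2008, §0 p.11] -/
theorem comp_gpPerfSectionU_eq_id (hB : IsPerfect B) (δ : B →* Algebra.GrothendieckGroup (Perfection M))
    (σ₀ : M →* B) (h : ∀ a, δ (σ₀ a) = Algebra.GrothendieckGroup.of (Perfection.of M a)) :
    δ.comp (gpPerfSectionU hB σ₀) = MonoidHom.id _ := by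
  apply gp_hom_ext
  rw [MonoidHom.id_comp, MonoidHom.comp_assoc]
  have h1 : (gpPerfSectionU hB σ₀).comp Algebra.GrothendieckGroup.of = Perfection.extendU hB σ₀ :=
    MonoidHom.ext (gpPerfSectionU_of hB σ₀)
  rw [h1]
  apply Perfection.hom_ext_of_isPerfect (isPerfect_gp_perfection M)
  rw [MonoidHom.comp_assoc, Perfection.extendU_comp_of]
  exact MonoidHom.ext h

/-- Pointwise form. [cite: MochizukiFrdI2008, §0 p.11] -/
theorem apply_gpPerfSectionU (hB : IsPerfect B) (δ : B →* Algebra.GrothendieckGroup (Perfection M))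
    (σ₀ : M →* B) (h : ∀ a, δ (σ₀ a) = Algebra.GrothendieckGroup.of (Perfection.of M a))
    (x : Algebra.GrothendieckGroup (Perfection M)) : δ (gpPerfSectionU hB σ₀ x) = x :=
  DFunLike.congr_fun (comp_gpPerfSectionU_eq_id hB δ σ₀ h) x

end Sections

end Literature.AlgebraicGeometry.Frobenioids

end
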